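import Mathlib

/-!
Sketch for crux-ideate stmt-ABC-1649 (TowerFourSubLiouville), ideator 2, round 1.
First lemmas of the two idea cards, stated over Mathlib only (no proofs required here).
-/

namespace Summit.ABC.ABC.Cruxes.TowerFourSubLiouville.Sketch

open WeierstrassCurve

/-! ### Card `isotypic-demjanenko-manin` -/

/-- The CM curve `E_w : y² = x³ − w·x` (quartic twist of `y² = x³ − x`, j = 1728). -/
def Ew (w : ℚ) : WeierstrassCurve ℚ := ⟨0, 0, 0, -w, 0⟩

/-- Elementary rendering of `rank E_w(ℚ) ≤ 1`: one rational point generates the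
Mordell–Weil group up to torsion. -/
def RankLeOne (w : ℚ) : Prop :=
  ∃ G : (Ew w).toAffine.Point, ∀ P : (Ew w).toAffine.Point, ∃ n : ℤ, IsOfFinAddOrder (P - n • G)

/-- First lemma of the isotypic line (Dem'janenko–Manin made polynomial by Hindry–Silverman):
on the isotypic slice `X⁴ + Y⁴ = w·Z⁴` of the crux, rank ≤ 1 of `E_w(ℚ)` forces a bound
`Z ≤ C·w^K` with ABSOLUTE constants (Dem'janenko 1966 even gives: no point with `X ≠ Y`). -/
def IsotypicSubLiouville : Prop :=
  ∃ K C : ℝ, 0 < C ∧ ∀ w : ℕ, 0 < w → RankLeOne (w : ℚ) →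
    ∀ X Y Z : ℕ, 0 < X → 0 < Y → 0 < Z → Nat.Coprime X Y →
      X ^ 4 + Y ^ 4 = w * Z ^ 4 → (Z : ℝ) ≤ C * (w : ℝ) ^ K

/-- The two Dem'janenko–Manin points attached to a solution of `X⁴ + Y⁴ = w Z⁴` lie on `E_w`
(pure algebra; the content of the line is that they have EQUAL naive height `log (w Z²)`). -/
def ManinPointsOnCurve : Prop :=
  ∀ w X Y Z : ℚ, X ≠ 0 → Y ≠ 0 → X ^ 4 + Y ^ 4 = w * Z ^ 4 →
    (Ew w).toAffine.Equation (w * Z ^ 2 / Y ^ 2) (w * X ^ 2 * Z / Y ^ 3) ∧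
    (Ew w).toAffine.Equation (w * Z ^ 2 / X ^ 2) (w * Y ^ 2 * Z / X ^ 3)

/-! ### Card `anchored-thue-siegel-slice` -/

/-- First lemma of the anchored line (Thue–Siegel principle with the X-freedom: every hard
solution of a twist `(v, w)` approximates the same `θ = (v/w)^{1/4}`): if the twist has ONE
good solution `(Y₀, Z₀)` (quality: `m₀² ≤ Y₀`) that is not too small (`(v w)^c₀ ≤ Y₀`), then EVERY
good solution `(Y, Z)` (any small value `m`, in particular every `m = u X⁴` of the crux) satisfies
`Y ≤ C · Y₀ ^ K` with absolute `K, C, c₀`. With `Y₀ ≤ (v w)^B` this is a polynomial bound. -/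
def AnchoredSubLiouville : Prop :=
  ∃ K C c₀ : ℝ, 0 < C ∧ 0 < c₀ ∧ ∀ v w : ℕ, 0 < v → 0 < w →
    ∀ Y₀ Z₀ : ℕ, 0 < Y₀ → ((v * w : ℕ) : ℝ) ^ c₀ ≤ Y₀ →
      ((w : ℤ) * Z₀ ^ 4 - v * Y₀ ^ 4) ≠ 0 → ((w : ℤ) * Z₀ ^ 4 - v * Y₀ ^ 4) ^ 2 ≤ Y₀ →
      ∀ Y Z : ℕ, 0 < Y → Nat.Coprime Y Z →
        ((w : ℤ) * Z ^ 4 - v * Y ^ 4) ≠ 0 → ((w : ℤ) * Z ^ 4 - v * Y ^ 4) ^ 2 ≤ Y →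
        (Y : ℝ) ≤ C * (Y₀ : ℝ) ^ K

/-! ### The common reformulation used by both cards (elementary, provable now) -/

/-- `d₄ n` = least `d ≥ 1` with `n·d` a fourth power (the "fourth-power completion defect");
here rendered through the factorization: `∏ p ^ ((4 - v_p(n) % 4) % 4)`. -/
def d4 (n : ℕ) : ℕ := n.factorization.prod fun p e => p ^ ((4 - e % 4) % 4)

/-- HardCore form of the crux: `min(a,b) · d₄(a) d₄(b) d₄(c) ≥ C · c^δ` for all coprime
`a + b = c`. Claim (both cards, §Why it bites): `TowerFourSubLiouville ↔ HardCore`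
(elementary: the minimum of `∏ xᵢ` over level-4 tower factorizations of `a` is `r₄(a)` with
`r₄(a)⁴ = a · d₄(a)`, and `abc ≥ c²/2`). -/
def HardCore : Prop :=
  ∃ δ C : ℝ, 0 < δ ∧ 0 < C ∧ ∀ a b c : ℕ, 0 < a → 0 < b → a + b = c → Nat.Coprime a b →
    C * (c : ℝ) ^ δ ≤ ((min a b * d4 a * d4 b * d4 c : ℕ) : ℝ)

/-- Uniform Thue inequality for pure quartic radicals (UT4). Claim: `HardCore ↔ UT4`
(violating sequences of either are violating sequences of the other: a hard triple is
`(m, vY⁴, wZ⁴)` with `m·v·w = c^{o(1)}`). -/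
def UT4 : Prop :=
  ∃ τ K C : ℝ, 0 < τ ∧ 0 < C ∧ ∀ v w Y Z : ℕ, 0 < v → 0 < w → 0 < Y → 0 < Z → Nat.Coprime Y Z →
    (w : ℤ) * Z ^ 4 ≠ v * Y ^ 4 →
    C * (Z : ℝ) ^ τ ≤ |((w : ℤ) * Z ^ 4 - v * Y ^ 4 : ℤ)| * ((v * w : ℕ) : ℝ) ^ K

end Summit.ABC.ABC.Cruxes.TowerFourSubLiouville.Sketch
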